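/-
Copyright: harness cell b2b-lgcu-borel (gen 26).  Honest framing: the VALUE here is a THEOREM
(a decidable NEGATIVE verdict on an infinite slice of the crux: all subgroup triples of
`GL_3(𝔽_p)`, `p ∈ {11, 13, 17, 19}`, below an explicit `ε`) — NOT summit progress; the crux item
`SubgroupIdentityDesigns` (stmt-MatrixMultiplication-14079) stays open and untouched.
-/
import Mathlib
import Literature.Barriers.RiemannHypothesis.EpsteinZetaRealZerosIntegralWitness
import Summits.MatrixMultiplication.MatrixMultiplication.Theorems.SubgroupIdentityDesigns.Negative.LevelOneEpsilonFloor

/-!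
# The `ε`-window of the first open level-one cells: `(m, p) = (3, 11), (3, 13), (3, 17), (3, 19)`

Route `LevelGradedCohnUmans`, crux `SubgroupIdentityDesigns`, negative side; level `k = 1`.

`LevelOneSmallPrimes` closes the level-one slice at every prime `p ≤ 7` (`0 < ε ≤ 1`) and explains
why its volume law cannot exclude `p ≥ 11` at `ε = 1`.  With the floor at a general exponent
(`LevelOneEpsilonFloor.floor_exp`: `1 + (b−1)^t + (p−2) b^t < V^{t/3}` for every `t ≥ 2 + ε`) the
same volume law `V + u²(u−1) ≤ uD` DOES exclude the first open cells below an explicit `ε`: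

* `cert_eleven`, …, `cert_nineteen` : pure arithmetic certificates (`D ≤ (p−1)b² + 2 − 2b`, the
  integer maximum `M` of `uD − u³ + u²`, integer root bounds `c₂ ≤ (b−1)^t`, `c₁ ≤ b^t` from
  `c^n ≤ x^k`, and `M^{t/3} ≤ 1 + c₂ + (p−2)c₁` from `M^k ≤ A₀^n`, all by `norm_num`; generated and
  checked exactly by `code/g26/lean/gen_cells.py`);
* `no_levelOne_witness_three_eleven` : **at `(m, p) = (3, 11)` NO subgroup-TPP triple with a
  level-one identity design satisfies the crux inequality for ANY `−2 < ε ≤ 3/4`** (`t = 11/4`;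
  `V ≤ 28 630 260` against the floor `(1 + 132^{11/4} + 9·133^{11/4})^{12/11} ≈ 28.94·10⁶`, margin
  1.1 %; the method's exact reach is `ε* ≈ 0.7618`);
* `no_levelOne_witness_three_thirteen` : the same at `(3, 13)` for `−2 < ε ≤ 2/3` (`t = 8/3`;
  `V ≤ 98 056 524`, floor `≈ 100.2·10⁶`; reach `ε* ≈ 0.687`);
* `no_levelOne_witness_three_seventeen` / `_nineteen` : `(3, 17)`, `(3, 19)` for `−2 < ε ≤ 1/2`
  (`t = 5/2`; reach `ε* ≈ 0.595`, `0.564`);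
* `no_crux_instance_three_eleven`, `no_crux_instance_three_thirteen`,
  `no_crux_instance_three_seventeen_nineteen` : the crux clause verbatim at `m = 3`.

So the first open cells of the level-one slice in dimension three are open ONLY in the windows
`ε ∈ (3/4, 1]` (`p = 11`), `(2/3, 1]` (`p = 13`), `(1/2, 1]` (`p = 17, 19`); `ε*(p) → 0` like
`≈ 0.85 / log p`, so nothing here is uniform in `p` (the route's bet is `p → ∞`).  The window at
`p = 11` is the object of the structured member census of gen 26.  Sorry-free; standard axioms; no
new definitions.  Report: `run/shared/lean/b2b/levelgraded-cu/ORACLE-g26.md` §G26-1/2.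
-/

set_option linter.dupNamespace false

noncomputable section

open scoped BigOperators Classical Matrix
open Module (finrank)

namespace Summit.MatrixMultiplication.MatrixMultiplication.Theorems.SubgroupIdentityDesigns.Negative
namespace LevelOneEpsilonCells

open Literature.Barriers.MatrixMultiplication (SubgroupTPP)
open Summit.MatrixMultiplication.MatrixMultiplication.Theorems.LieRankDesigns.Negative
  (GLm Mat budget)
open Summit.MatrixMultiplication.MatrixMultiplication.Theorems.LevelOneGL2Designs.Negative
  (levelSubmodule)
open LevelOneFloorAll (finrank_le_formula_nat)
open WitnessNeumannCounts (crux_volume_law)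
open LevelOneEpsilonFloor (floor_exp volume_cap quad_trichotomy volume_real cell_absurd)
-- root comparisons `c^n ≤ x^k ⇒ c ≤ x^{k/n}` (generic real-analysis helpers already in the tree)
open Literature.Barriers.RiemannHypothesis (le_rpow_of_pow_le rpow_le_of_pow_le)

variable {p : ℕ} [hp : Fact p.Prime]

/-! ## The cell `(3, 11)`: no witness unless `ε > 3/4`; the cell `(3, 13)`: unless `ε > 2/3` -/

/-- Arithmetic certificate of the cell `(3, 11)`: `D ≤ 176626`, volume cap `V ≤ 28630260`
(`u = 243`), floor exponent `t = 11/4`: `678544 ≤ 132^t`, `692774 ≤ 133^t`,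
`28630260^(t/3) ≤ 6913511`. -/
theorem cert_eleven {u D V : ℕ} (hu1 : 1 ≤ u) (hvol : V + u * u * (u - 1) ≤ u * D)
    (hD : D + 2 * 133 ≤ (11 - 1) * 133 ^ 2 + 2)
    (hfl : 1 + (((133 : ℕ) : ℝ) - 1) ^ ((11 : ℝ) / 4) +
      (((11 : ℕ) : ℝ) - 2) * ((133 : ℕ) : ℝ) ^ ((11 : ℝ) / 4) <
      ((V : ℕ) : ℝ) ^ ((11 : ℝ) / 4 / 3)) : False := by
  have hDm : D ≤ 176626 := by norm_num at hD; omega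
  obtain ⟨w, hw⟩ := volume_real hu1 hvol hDm
  have hw0 : (0 : ℝ) ≤ w := Nat.cast_nonneg _
  have hq := quad_trichotomy (w := w) (w₀ := 242) (D := ((176626 : ℕ) : ℝ)) (by norm_num)
    (by norm_num)
  have hcap := volume_cap (w₀ := ((242 : ℕ) : ℝ)) hw0 hw le_rfl hq
  have hVM : ((V : ℕ) : ℝ) ≤ 28630260 := by norm_num at hcap; exact_mod_cast hcap
  have e1 : (((133 : ℕ) : ℝ) - 1) = 132 := by norm_num
  have e2 : (((11 : ℕ) : ℝ) - 2) = 9 := by norm_num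
  have e3 : (((133 : ℕ) : ℝ)) = 133 := by norm_num
  have e4 : ((11 : ℝ) / 4 / 3) = (11 : ℝ) / 12 := by norm_num
  rw [e1, e2, e3, e4] at hfl
  have h2 : (678544 : ℝ) ≤ (132 : ℝ) ^ ((11 : ℝ) / 4) :=
    le_rpow_of_pow_le (k := 11) (n := 4) (by norm_num) (by norm_num) (by norm_num)
      (by norm_num) (by norm_num)
  have h1 : (692774 : ℝ) ≤ (133 : ℝ) ^ ((11 : ℝ) / 4) :=
    le_rpow_of_pow_le (k := 11) (n := 4) (by norm_num) (by norm_num) (by norm_num)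
      (by norm_num) (by norm_num)
  have hM : (28630260 : ℝ) ^ ((11 : ℝ) / 12) ≤ 1 + 678544 + 9 * 692774 :=
    rpow_le_of_pow_le (k := 11) (n := 12) (by norm_num) (by norm_num) (by norm_num)
      (by norm_num) (by norm_num)
  exact cell_absurd (Nat.cast_nonneg V) hVM (by norm_num) (by norm_num) hfl h2 h1 hM

/-- **NO LEVEL-ONE WITNESS AT `(m, p) = (3, 11)` FOR `−2 < ε ≤ 3/4`** (all subgroup triples; TPP and
a level-one identity design only feed the volume law). -/
theorem no_levelOne_witness_three_eleven (hp' : p = 11) {ε : ℝ} (hε : -2 < ε) (hε1 : ε ≤ 3 / 4)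
    {H₁ H₂ H₃ : Subgroup (GLm p (1 + 2))} (htpp : SubgroupTPP H₁ H₂ H₃)
    (hdes : ∃ c : Mat p (1 + 2) → ℂ, (∀ M, 1 < M.rank → c M = 0) ∧
      (∑ M, c M * ZMod.stdAddChar (Matrix.trace (M * ((1 : GLm p (1 + 2)) : Mat p (1 + 2))))) = 1 ∧
      ∀ a ∈ H₁, ∀ b ∈ H₂, ∀ g ∈ H₃, a * b * g ≠ 1 →
        (∑ M, c M * ZMod.stdAddChar
          (Matrix.trace (M * ((a * b * g : GLm p (1 + 2)) : Mat p (1 + 2))))) = 0) :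
    ¬ budget p (1 + 2) 1 (2 + ε) <
      ((Nat.card H₁ * Nat.card H₂ * Nat.card H₃ : ℕ) : ℝ) ^ ((2 + ε) / 3) := by
  intro hlt
  subst hp'
  obtain ⟨u, hu1, -, -, -, -, hvol⟩ := crux_volume_law (k := 1) htpp hdes
  have hfl := floor_exp (p := 11) (l := 2) (t := (11 : ℝ) / 4) (by omega) hε (by linarith) hlt
  have hD := finrank_le_formula_nat (p := 11) (l := 2)
  have hb : (11 ^ (1 + 2) - 1) / (11 - 1) = 133 := by norm_num
  rw [hb] at hfl hD
  generalize finrank ℂ (levelSubmodule 11 (1 + 2) 1) = D at hD hvol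
  generalize Nat.card H₁ * Nat.card H₂ * Nat.card H₃ = V at hfl hvol
  exact cert_eleven hu1 hvol hD hfl

/-- Arithmetic certificate of the cell `(3, 13)`: `D ≤ 401504`, volume cap `V ≤ 98056524`
(`u = 366`), floor exponent `t = 8/3`: `1063792 ≤ 182^t`, `1079450 ≤ 183^t`,
`98056524^(t/3) ≤ 12937743`. -/
theorem cert_thirteen {u D V : ℕ} (hu1 : 1 ≤ u) (hvol : V + u * u * (u - 1) ≤ u * D)
    (hD : D + 2 * 183 ≤ (13 - 1) * 183 ^ 2 + 2)
    (hfl : 1 + (((183 : ℕ) : ℝ) - 1) ^ ((8 : ℝ) / 3) +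
      (((13 : ℕ) : ℝ) - 2) * ((183 : ℕ) : ℝ) ^ ((8 : ℝ) / 3) <
      ((V : ℕ) : ℝ) ^ ((8 : ℝ) / 3 / 3)) : False := by
  have hDm : D ≤ 401504 := by norm_num at hD; omega
  obtain ⟨w, hw⟩ := volume_real hu1 hvol hDm
  have hw0 : (0 : ℝ) ≤ w := Nat.cast_nonneg _
  have hq := quad_trichotomy (w := w) (w₀ := 365) (D := ((401504 : ℕ) : ℝ)) (by norm_num)
    (by norm_num)
  have hcap := volume_cap (w₀ := ((365 : ℕ) : ℝ)) hw0 hw le_rfl hq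
  have hVM : ((V : ℕ) : ℝ) ≤ 98056524 := by norm_num at hcap; exact_mod_cast hcap
  have e1 : (((183 : ℕ) : ℝ) - 1) = 182 := by norm_num
  have e2 : (((13 : ℕ) : ℝ) - 2) = 11 := by norm_num
  have e3 : (((183 : ℕ) : ℝ)) = 183 := by norm_num
  have e4 : ((8 : ℝ) / 3 / 3) = (8 : ℝ) / 9 := by norm_num
  rw [e1, e2, e3, e4] at hfl
  have h2 : (1063792 : ℝ) ≤ (182 : ℝ) ^ ((8 : ℝ) / 3) :=
    le_rpow_of_pow_le (k := 8) (n := 3) (by norm_num) (by norm_num) (by norm_num)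
      (by norm_num) (by norm_num)
  have h1 : (1079450 : ℝ) ≤ (183 : ℝ) ^ ((8 : ℝ) / 3) :=
    le_rpow_of_pow_le (k := 8) (n := 3) (by norm_num) (by norm_num) (by norm_num)
      (by norm_num) (by norm_num)
  have hM : (98056524 : ℝ) ^ ((8 : ℝ) / 9) ≤ 1 + 1063792 + 11 * 1079450 :=
    rpow_le_of_pow_le (k := 8) (n := 9) (by norm_num) (by norm_num) (by norm_num)
      (by norm_num) (by norm_num)
  exact cell_absurd (Nat.cast_nonneg V) hVM (by norm_num) (by norm_num) hfl h2 h1 hM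

/-- **NO LEVEL-ONE WITNESS AT `(m, p) = (3, 13)` FOR `−2 < ε ≤ 2/3`** (all subgroup triples; TPP and
a level-one identity design only feed the volume law). -/
theorem no_levelOne_witness_three_thirteen (hp' : p = 13) {ε : ℝ} (hε : -2 < ε) (hε1 : ε ≤ 2 / 3)
    {H₁ H₂ H₃ : Subgroup (GLm p (1 + 2))} (htpp : SubgroupTPP H₁ H₂ H₃)
    (hdes : ∃ c : Mat p (1 + 2) → ℂ, (∀ M, 1 < M.rank → c M = 0) ∧
      (∑ M, c M * ZMod.stdAddChar (Matrix.trace (M * ((1 : GLm p (1 + 2)) : Mat p (1 + 2))))) = 1 ∧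
      ∀ a ∈ H₁, ∀ b ∈ H₂, ∀ g ∈ H₃, a * b * g ≠ 1 →
        (∑ M, c M * ZMod.stdAddChar
          (Matrix.trace (M * ((a * b * g : GLm p (1 + 2)) : Mat p (1 + 2))))) = 0) :
    ¬ budget p (1 + 2) 1 (2 + ε) <
      ((Nat.card H₁ * Nat.card H₂ * Nat.card H₃ : ℕ) : ℝ) ^ ((2 + ε) / 3) := by
  intro hlt
  subst hp'
  obtain ⟨u, hu1, -, -, -, -, hvol⟩ := crux_volume_law (k := 1) htpp hdes
  have hfl := floor_exp (p := 13) (l := 2) (t := (8 : ℝ) / 3) (by omega) hε (by linarith) hlt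
  have hD := finrank_le_formula_nat (p := 13) (l := 2)
  have hb : (13 ^ (1 + 2) - 1) / (13 - 1) = 183 := by norm_num
  rw [hb] at hfl hD
  generalize finrank ℂ (levelSubmodule 13 (1 + 2) 1) = D at hD hvol
  generalize Nat.card H₁ * Nat.card H₂ * Nat.card H₃ = V at hfl hvol
  exact cert_thirteen hu1 hvol hD hfl

/-! ## The cells `(3, 17)` and `(3, 19)`: no witness unless `ε > 1/2` -/

/-- Arithmetic certificate of the cell `(3, 17)`: `D ≤ 1507372`, volume cap `V ≤ 712828600`
(`u = 709`), floor exponent `t = 5/2`: `1637961 ≤ 306^t`, `1651375 ≤ 307^t`,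
`712828600^(t/3) ≤ 26408587`. -/
theorem cert_seventeen {u D V : ℕ} (hu1 : 1 ≤ u) (hvol : V + u * u * (u - 1) ≤ u * D)
    (hD : D + 2 * 307 ≤ (17 - 1) * 307 ^ 2 + 2)
    (hfl : 1 + (((307 : ℕ) : ℝ) - 1) ^ ((5 : ℝ) / 2) +
      (((17 : ℕ) : ℝ) - 2) * ((307 : ℕ) : ℝ) ^ ((5 : ℝ) / 2) <
      ((V : ℕ) : ℝ) ^ ((5 : ℝ) / 2 / 3)) : False := by
  have hDm : D ≤ 1507372 := by norm_num at hD; omega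
  obtain ⟨w, hw⟩ := volume_real hu1 hvol hDm
  have hw0 : (0 : ℝ) ≤ w := Nat.cast_nonneg _
  have hq := quad_trichotomy (w := w) (w₀ := 708) (D := ((1507372 : ℕ) : ℝ)) (by norm_num)
    (by norm_num)
  have hcap := volume_cap (w₀ := ((708 : ℕ) : ℝ)) hw0 hw le_rfl hq
  have hVM : ((V : ℕ) : ℝ) ≤ 712828600 := by norm_num at hcap; exact_mod_cast hcap
  have e1 : (((307 : ℕ) : ℝ) - 1) = 306 := by norm_num
  have e2 : (((17 : ℕ) : ℝ) - 2) = 15 := by norm_num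
  have e3 : (((307 : ℕ) : ℝ)) = 307 := by norm_num
  have e4 : ((5 : ℝ) / 2 / 3) = (5 : ℝ) / 6 := by norm_num
  rw [e1, e2, e3, e4] at hfl
  have h2 : (1637961 : ℝ) ≤ (306 : ℝ) ^ ((5 : ℝ) / 2) :=
    le_rpow_of_pow_le (k := 5) (n := 2) (by norm_num) (by norm_num) (by norm_num)
      (by norm_num) (by norm_num)
  have h1 : (1651375 : ℝ) ≤ (307 : ℝ) ^ ((5 : ℝ) / 2) :=
    le_rpow_of_pow_le (k := 5) (n := 2) (by norm_num) (by norm_num) (by norm_num)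
      (by norm_num) (by norm_num)
  have hM : (712828600 : ℝ) ^ ((5 : ℝ) / 6) ≤ 1 + 1637961 + 15 * 1651375 :=
    rpow_le_of_pow_le (k := 5) (n := 6) (by norm_num) (by norm_num) (by norm_num)
      (by norm_num) (by norm_num)
  exact cell_absurd (Nat.cast_nonneg V) hVM (by norm_num) (by norm_num) hfl h2 h1 hM

/-- **NO LEVEL-ONE WITNESS AT `(m, p) = (3, 17)` FOR `−2 < ε ≤ 1/2`** (all subgroup triples; TPP and
a level-one identity design only feed the volume law). -/
theorem no_levelOne_witness_three_seventeen (hp' : p = 17) {ε : ℝ} (hε : -2 < ε) (hε1 : ε ≤ 1 / 2)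
    {H₁ H₂ H₃ : Subgroup (GLm p (1 + 2))} (htpp : SubgroupTPP H₁ H₂ H₃)
    (hdes : ∃ c : Mat p (1 + 2) → ℂ, (∀ M, 1 < M.rank → c M = 0) ∧
      (∑ M, c M * ZMod.stdAddChar (Matrix.trace (M * ((1 : GLm p (1 + 2)) : Mat p (1 + 2))))) = 1 ∧
      ∀ a ∈ H₁, ∀ b ∈ H₂, ∀ g ∈ H₃, a * b * g ≠ 1 →
        (∑ M, c M * ZMod.stdAddChar
          (Matrix.trace (M * ((a * b * g : GLm p (1 + 2)) : Mat p (1 + 2))))) = 0) :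
    ¬ budget p (1 + 2) 1 (2 + ε) <
      ((Nat.card H₁ * Nat.card H₂ * Nat.card H₃ : ℕ) : ℝ) ^ ((2 + ε) / 3) := by
  intro hlt
  subst hp'
  obtain ⟨u, hu1, -, -, -, -, hvol⟩ := crux_volume_law (k := 1) htpp hdes
  have hfl := floor_exp (p := 17) (l := 2) (t := (5 : ℝ) / 2) (by omega) hε (by linarith) hlt
  have hD := finrank_le_formula_nat (p := 17) (l := 2)
  have hb : (17 ^ (1 + 2) - 1) / (17 - 1) = 307 := by norm_num
  rw [hb] at hfl hD
  generalize finrank ℂ (levelSubmodule 17 (1 + 2) 1) = D at hD hvol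
  generalize Nat.card H₁ * Nat.card H₂ * Nat.card H₃ = V at hfl hvol
  exact cert_seventeen hu1 hvol hD hfl

/-- Arithmetic certificate of the cell `(3, 19)`: `D ≤ 2612138`, volume cap `V ≤ 1625829006`
(`u = 933`), floor exponent `t = 5/2`: `2814874 ≤ 380^t`, `2833429 ≤ 381^t`,
`1625829006^(t/3) ≤ 50983168`. -/
theorem cert_nineteen {u D V : ℕ} (hu1 : 1 ≤ u) (hvol : V + u * u * (u - 1) ≤ u * D)
    (hD : D + 2 * 381 ≤ (19 - 1) * 381 ^ 2 + 2)
    (hfl : 1 + (((381 : ℕ) : ℝ) - 1) ^ ((5 : ℝ) / 2) +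
      (((19 : ℕ) : ℝ) - 2) * ((381 : ℕ) : ℝ) ^ ((5 : ℝ) / 2) <
      ((V : ℕ) : ℝ) ^ ((5 : ℝ) / 2 / 3)) : False := by
  have hDm : D ≤ 2612138 := by norm_num at hD; omega
  obtain ⟨w, hw⟩ := volume_real hu1 hvol hDm
  have hw0 : (0 : ℝ) ≤ w := Nat.cast_nonneg _
  have hq := quad_trichotomy (w := w) (w₀ := 932) (D := ((2612138 : ℕ) : ℝ)) (by norm_num)
    (by norm_num)
  have hcap := volume_cap (w₀ := ((932 : ℕ) : ℝ)) hw0 hw le_rfl hq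
  have hVM : ((V : ℕ) : ℝ) ≤ 1625829006 := by norm_num at hcap; exact_mod_cast hcap
  have e1 : (((381 : ℕ) : ℝ) - 1) = 380 := by norm_num
  have e2 : (((19 : ℕ) : ℝ) - 2) = 17 := by norm_num
  have e3 : (((381 : ℕ) : ℝ)) = 381 := by norm_num
  have e4 : ((5 : ℝ) / 2 / 3) = (5 : ℝ) / 6 := by norm_num
  rw [e1, e2, e3, e4] at hfl
  have h2 : (2814874 : ℝ) ≤ (380 : ℝ) ^ ((5 : ℝ) / 2) :=
    le_rpow_of_pow_le (k := 5) (n := 2) (by norm_num) (by norm_num) (by norm_num)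
      (by norm_num) (by norm_num)
  have h1 : (2833429 : ℝ) ≤ (381 : ℝ) ^ ((5 : ℝ) / 2) :=
    le_rpow_of_pow_le (k := 5) (n := 2) (by norm_num) (by norm_num) (by norm_num)
      (by norm_num) (by norm_num)
  have hM : (1625829006 : ℝ) ^ ((5 : ℝ) / 6) ≤ 1 + 2814874 + 17 * 2833429 :=
    rpow_le_of_pow_le (k := 5) (n := 6) (by norm_num) (by norm_num) (by norm_num)
      (by norm_num) (by norm_num)
  exact cell_absurd (Nat.cast_nonneg V) hVM (by norm_num) (by norm_num) hfl h2 h1 hM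

/-- **NO LEVEL-ONE WITNESS AT `(m, p) = (3, 19)` FOR `−2 < ε ≤ 1/2`** (all subgroup triples; TPP and
a level-one identity design only feed the volume law). -/
theorem no_levelOne_witness_three_nineteen (hp' : p = 19) {ε : ℝ} (hε : -2 < ε) (hε1 : ε ≤ 1 / 2)
    {H₁ H₂ H₃ : Subgroup (GLm p (1 + 2))} (htpp : SubgroupTPP H₁ H₂ H₃)
    (hdes : ∃ c : Mat p (1 + 2) → ℂ, (∀ M, 1 < M.rank → c M = 0) ∧
      (∑ M, c M * ZMod.stdAddChar (Matrix.trace (M * ((1 : GLm p (1 + 2)) : Mat p (1 + 2))))) = 1 ∧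
      ∀ a ∈ H₁, ∀ b ∈ H₂, ∀ g ∈ H₃, a * b * g ≠ 1 →
        (∑ M, c M * ZMod.stdAddChar
          (Matrix.trace (M * ((a * b * g : GLm p (1 + 2)) : Mat p (1 + 2))))) = 0) :
    ¬ budget p (1 + 2) 1 (2 + ε) <
      ((Nat.card H₁ * Nat.card H₂ * Nat.card H₃ : ℕ) : ℝ) ^ ((2 + ε) / 3) := by
  intro hlt
  subst hp'
  obtain ⟨u, hu1, -, -, -, -, hvol⟩ := crux_volume_law (k := 1) htpp hdes
  have hfl := floor_exp (p := 19) (l := 2) (t := (5 : ℝ) / 2) (by omega) hε (by linarith) hlt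
  have hD := finrank_le_formula_nat (p := 19) (l := 2)
  have hb : (19 ^ (1 + 2) - 1) / (19 - 1) = 381 := by norm_num
  rw [hb] at hfl hD
  generalize finrank ℂ (levelSubmodule 19 (1 + 2) 1) = D at hD hvol
  generalize Nat.card H₁ * Nat.card H₂ * Nat.card H₃ = V at hfl hvol
  exact cert_nineteen hu1 hvol hD hfl

/-! ## The crux clause verbatim at `m = 3` -/

/-- **The crux clause verbatim has no level-one instance at `(m, p) = (3, 11)` for any
`−2 < ε ≤ 3/4`** — the cell is open only in the window `ε ∈ (3/4, 1]`. -/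
theorem no_crux_instance_three_eleven (hp' : p = 11) {ε : ℝ} (hε : -2 < ε) (hε1 : ε ≤ 3 / 4) :
    ¬ ∃ (H₁ H₂ H₃ : Subgroup (Matrix.GeneralLinearGroup (Fin 3) (ZMod p))),
      Literature.Barriers.MatrixMultiplication.SubgroupTPP H₁ H₂ H₃ ∧
      (∃ c : Matrix (Fin 3) (Fin 3) (ZMod p) → ℂ, (∀ M, 1 < M.rank → c M = 0) ∧
        (∑ M : Matrix (Fin 3) (Fin 3) (ZMod p), c M * ZMod.stdAddChar
          (Matrix.trace (M * ((1 : Matrix.GeneralLinearGroup (Fin 3) (ZMod p)) :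
            Matrix (Fin 3) (Fin 3) (ZMod p))))) = 1 ∧
        ∀ a ∈ H₁, ∀ b ∈ H₂, ∀ g ∈ H₃, a * b * g ≠ 1 →
          (∑ M : Matrix (Fin 3) (Fin 3) (ZMod p), c M * ZMod.stdAddChar
            (Matrix.trace (M * ((a * b * g : Matrix.GeneralLinearGroup (Fin 3) (ZMod p)) :
              Matrix (Fin 3) (Fin 3) (ZMod p))))) = 0) ∧
      (∑ᶠ χ ∈ Literature.RepresentationTheory.FiniteGroups.irrChars
          (Matrix.GeneralLinearGroup (Fin 3) (ZMod p)) ∩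
          {f | ∃ c : Matrix (Fin 3) (Fin 3) (ZMod p) → ℂ, (∀ M, 1 < M.rank → c M = 0) ∧
            ∀ g : Matrix.GeneralLinearGroup (Fin 3) (ZMod p), f g =
              ∑ M : Matrix (Fin 3) (Fin 3) (ZMod p), c M * ZMod.stdAddChar
                (Matrix.trace (M * (g : Matrix (Fin 3) (Fin 3) (ZMod p))))},
        (χ 1).re ^ (2 + ε)) <
        ((Nat.card H₁ * Nat.card H₂ * Nat.card H₃ : ℕ) : ℝ) ^ ((2 + ε) / 3) := by
  rintro ⟨H₁, H₂, H₃, htpp, hdesign, hlt⟩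
  exact no_levelOne_witness_three_eleven hp' hε hε1 htpp hdesign hlt

/-- **The crux clause verbatim has no level-one instance at `(m, p) = (3, 13)` for any
`−2 < ε ≤ 2/3`** — the cell is open only in the window `ε ∈ (2/3, 1]`. -/
theorem no_crux_instance_three_thirteen (hp' : p = 13) {ε : ℝ} (hε : -2 < ε) (hε1 : ε ≤ 2 / 3) :
    ¬ ∃ (H₁ H₂ H₃ : Subgroup (Matrix.GeneralLinearGroup (Fin 3) (ZMod p))),
      Literature.Barriers.MatrixMultiplication.SubgroupTPP H₁ H₂ H₃ ∧
      (∃ c : Matrix (Fin 3) (Fin 3) (ZMod p) → ℂ, (∀ M, 1 < M.rank → c M = 0) ∧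
        (∑ M : Matrix (Fin 3) (Fin 3) (ZMod p), c M * ZMod.stdAddChar
          (Matrix.trace (M * ((1 : Matrix.GeneralLinearGroup (Fin 3) (ZMod p)) :
            Matrix (Fin 3) (Fin 3) (ZMod p))))) = 1 ∧
        ∀ a ∈ H₁, ∀ b ∈ H₂, ∀ g ∈ H₃, a * b * g ≠ 1 →
          (∑ M : Matrix (Fin 3) (Fin 3) (ZMod p), c M * ZMod.stdAddChar
            (Matrix.trace (M * ((a * b * g : Matrix.GeneralLinearGroup (Fin 3) (ZMod p)) :
              Matrix (Fin 3) (Fin 3) (ZMod p))))) = 0) ∧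
      (∑ᶠ χ ∈ Literature.RepresentationTheory.FiniteGroups.irrChars
          (Matrix.GeneralLinearGroup (Fin 3) (ZMod p)) ∩
          {f | ∃ c : Matrix (Fin 3) (Fin 3) (ZMod p) → ℂ, (∀ M, 1 < M.rank → c M = 0) ∧
            ∀ g : Matrix.GeneralLinearGroup (Fin 3) (ZMod p), f g =
              ∑ M : Matrix (Fin 3) (Fin 3) (ZMod p), c M * ZMod.stdAddChar
                (Matrix.trace (M * (g : Matrix (Fin 3) (Fin 3) (ZMod p))))},
        (χ 1).re ^ (2 + ε)) <
        ((Nat.card H₁ * Nat.card H₂ * Nat.card H₃ : ℕ) : ℝ) ^ ((2 + ε) / 3) := by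
  rintro ⟨H₁, H₂, H₃, htpp, hdesign, hlt⟩
  exact no_levelOne_witness_three_thirteen hp' hε hε1 htpp hdesign hlt

/-- **The crux clause verbatim has no level-one instance at `(m, p) = (3, 17)` or `(3, 19)` for any
`−2 < ε ≤ 1/2`.** -/
theorem no_crux_instance_three_seventeen_nineteen (hp' : p = 17 ∨ p = 19) {ε : ℝ} (hε : -2 < ε)
    (hε1 : ε ≤ 1 / 2) :
    ¬ ∃ (H₁ H₂ H₃ : Subgroup (Matrix.GeneralLinearGroup (Fin 3) (ZMod p))),
      Literature.Barriers.MatrixMultiplication.SubgroupTPP H₁ H₂ H₃ ∧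
      (∃ c : Matrix (Fin 3) (Fin 3) (ZMod p) → ℂ, (∀ M, 1 < M.rank → c M = 0) ∧
        (∑ M : Matrix (Fin 3) (Fin 3) (ZMod p), c M * ZMod.stdAddChar
          (Matrix.trace (M * ((1 : Matrix.GeneralLinearGroup (Fin 3) (ZMod p)) :
            Matrix (Fin 3) (Fin 3) (ZMod p))))) = 1 ∧
        ∀ a ∈ H₁, ∀ b ∈ H₂, ∀ g ∈ H₃, a * b * g ≠ 1 →
          (∑ M : Matrix (Fin 3) (Fin 3) (ZMod p), c M * ZMod.stdAddChar
            (Matrix.trace (M * ((a * b * g : Matrix.GeneralLinearGroup (Fin 3) (ZMod p)) :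
              Matrix (Fin 3) (Fin 3) (ZMod p))))) = 0) ∧
      (∑ᶠ χ ∈ Literature.RepresentationTheory.FiniteGroups.irrChars
          (Matrix.GeneralLinearGroup (Fin 3) (ZMod p)) ∩
          {f | ∃ c : Matrix (Fin 3) (Fin 3) (ZMod p) → ℂ, (∀ M, 1 < M.rank → c M = 0) ∧
            ∀ g : Matrix.GeneralLinearGroup (Fin 3) (ZMod p), f g =
              ∑ M : Matrix (Fin 3) (Fin 3) (ZMod p), c M * ZMod.stdAddChar
                (Matrix.trace (M * (g : Matrix (Fin 3) (Fin 3) (ZMod p))))},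
        (χ 1).re ^ (2 + ε)) <
        ((Nat.card H₁ * Nat.card H₂ * Nat.card H₃ : ℕ) : ℝ) ^ ((2 + ε) / 3) := by
  rintro ⟨H₁, H₂, H₃, htpp, hdesign, hlt⟩
  rcases hp' with h | h
  · exact no_levelOne_witness_three_seventeen h hε hε1 htpp hdesign hlt
  · exact no_levelOne_witness_three_nineteen h hε hε1 htpp hdesign hlt

end LevelOneEpsilonCells

end Summit.MatrixMultiplication.MatrixMultiplication.Theorems.SubgroupIdentityDesigns.Negative
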